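import Literature.NumberTheory.GaloisRepresentations.NaturalIrrationalities
import HarnessLib

/-!
# `cd_p(k(t)) ≤ cd_p(k̄(t)) + cd_p(k)` from the Tower Theorem (Shatz IV §4, Serre II §4.2)

The displayed inequality of Shatz's proof of Tate's theorem (*Profinite groups, arithmetic, and
geometry*, Ch. IV §4 Thm. 28, case `k' = k(t)`, p. 119): "By the theorem on natural
irrationalities, `G_k = G(k̄(t)/k(t))` … But `G_k` is isomorphic to `G_{k(t)}/H`, so the Tower
Theorem yields `cd_p(k') ≤ cd_p H + cd_p(k)`" (`H = G(k̄(t)^alg/k̄(t))`; likewise Serre,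
*Cohomologie galoisienne*, II §4.2, proof of Prop. 11: "Comme `G_{k'}/H = G_k`, la prop. 15 du
Chapitre I donne l'inégalité cherchée"), **proved** on the Galois side — predicate
`Literature.NumberTheory.GaloisRepresentations.FieldCdLE`, `cd_p` of `Field.absoluteGaloisGroup`
(`CohomologicalDimension.lean`) — from the Tower Theorem alone (named fact
`tower_groupCdLE_of_isClosed_normal`, Shatz Ch. III §1 Thm. 13 = Serre I §3.3 Prop. 15), the
natural irrationalities being the theorems of `NaturalIrrationalities.lean`: for `K = k(t)` and
`Ω` an algebraic closure of `K`, the restriction `Aut_K(Ω) → Aut_k(k̄)`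
(`algEquivRestrictAlgebraicClosure`) is a continuous surjection of profinite groups
(`algEquivRestrictAlgebraicClosure_surjective`) whose kernel `N` is closed with `N ≃ₜ* Γ_{k̄(t)}`
(`kerRestrictContinuousMulEquivAbsoluteGaloisGroup`) and `Aut_K(Ω)/N ≃ₜ* Γ_k`
(`quotientKerRestrictContinuousMulEquivAbsoluteGaloisGroup`).

`Literature.AlgebraicGeometry.Motives.etaleCdLE_Spec_adjoin_simple_of_tower_of_galois`
(`EtaleCohomologicalDimensionGalois.lean`) is the étale reading of the same step, obtained from
`fieldCdLE_adjoin_simple_of_tower` through the dictionary `etaleCdLE_spec_iff_fieldCdLE` and the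
discharged Tower Theorem (`tower_groupCdLE_of_isClosed_normal_holds`,
`CohomologicalDimensionTowerProofs.lean`); `CohomologicalDimensionTranscendental.lean` combines
`fieldCdLE_adjoin_simple_of_tower` with Tsen's `cd ≤ 1` into the case `k' = k(t)` of Tate's
theorem (`fieldCdLE_adjoin_simple_of_tsen`) and Tate's theorem itself
(`fieldCdLE_of_trdeg_of_tsen`). (Until the D-0026 split review of 2026-08-15 the étale reading
was the named fact `tower_etaleCdLE_adjoin_simple`, of which `fieldCdLE_adjoin_simple_of_tower` is
the `FieldCdLE` form.)

## References

* S. S. Shatz, *Profinite groups, arithmetic, and geometry* (1972): Ch. III §1 Thm. 13 (Tower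
  Theorem); Ch. IV §4, proof of Thm. 28, p. 119. [Shatz1972]
* J.-P. Serre, *Cohomologie galoisienne*: I §3.3 Prop. 15; II §4.2, proof of Prop. 11.
  [SerreGaloisCohomology1997]
-/

noncomputable section

open Field

namespace Literature.NumberTheory.GaloisRepresentations

universe u

/-- **`cd_p(k(t)) ≤ cd_p(k̄(t)) + cd_p(k)` from the Tower Theorem** (Shatz Ch. IV §4, proof of
Thm. 28, p. 119: "`G_k` is isomorphic to `G_{k(t)}/H`, so the Tower Theorem yields
`cd_p(k') ≤ cd_p H + cd_p(k)`"; Serre II §4.2, proof of Prop. 11), for the predicate `FieldCdLE`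
(`cd_p` of `Field.absoluteGaloisGroup`): for `K = k(t)` a simple transcendental extension (`t`
transcendental over `k`, `IntermediateField.adjoin k {t} = ⊤`), `Ω` an algebraic closure of `K`,
`k̄ = algebraicClosure k Ω` and `k̄(t) = IntermediateField.adjoin k̄ {t} ⊆ Ω`:
`cd_p(k) ≤ m → cd_p(k̄(t)) ≤ m' → cd_p(K) ≤ m' + m`. Proof: `N = ker (Aut_K(Ω) → Aut_k(k̄))` is
a closed normal subgroup of the profinite group `Aut_K(Ω) ≃ₜ* Γ_K`
(`fieldCdLE_iff_groupCdLE_algEquiv`) with `N ≃ₜ* Γ_{k̄(t)}` and, the restriction being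
surjective (natural irrationalities), `Aut_K(Ω)/N ≃ₜ* Γ_k` (`NaturalIrrationalities.lean`); the
Tower Theorem for `N ⊴ Aut_K(Ω)` and the invariance of `cd_p` under `≃ₜ*`
(`GroupCdLE.of_continuousMulEquiv`) conclude. Conditional only on the Tower Theorem (named fact
`tower_groupCdLE_of_isClosed_normal`). [cite: Shatz1972, Ch. IV §4, proof of Thm. 28, p. 119]
[cite: SerreGaloisCohomology1997, II §4.2, proof of Prop. 11] -/
theorem fieldCdLE_adjoin_simple_of_tower (hT : tower_groupCdLE_of_isClosed_normal.{u})
    (k K Ω : Type u) [Field k] [Field K] [Field Ω] [Algebra k K] [Algebra K Ω] [Algebra k Ω]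
    [IsScalarTower k K Ω] [IsAlgClosure K Ω] (t : K) (ht : Transcendental k t)
    (htop : IntermediateField.adjoin k ({t} : Set K) = ⊤) (p : ℕ) [Fact p.Prime] (m m' : ℕ)
    (hk : FieldCdLE k p m)
    (hL : FieldCdLE
      (IntermediateField.adjoin (algebraicClosure k Ω) ({algebraMap K Ω t} : Set Ω)) p m') :
    FieldCdLE K p (m' + m) := by
  haveI : IsAlgClosed Ω := IsAlgClosure.isAlgClosed K
  haveI : CompactSpace (Ω ≃ₐ[K] Ω) := compactSpace_algEquiv_of_isAlgClosure K Ω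
  haveI : T2Space (Ω ≃ₐ[K] Ω) := krullTopology_t2
  let N : Subgroup (Ω ≃ₐ[K] Ω) := (algEquivRestrictAlgebraicClosure k K Ω).ker
  have hN : GroupCdLE N p m' :=
    GroupCdLE.of_continuousMulEquiv (kerRestrictContinuousMulEquivAbsoluteGaloisGroup htop).symm
      hL
  have hQ : GroupCdLE ((Ω ≃ₐ[K] Ω) ⧸ N) p m :=
    GroupCdLE.of_continuousMulEquiv
      (quotientKerRestrictContinuousMulEquivAbsoluteGaloisGroup
        (algEquivRestrictAlgebraicClosure_surjective ht htop)).symm hk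
  have hG : GroupCdLE (Ω ≃ₐ[K] Ω) p (m' + m) :=
    hT (Ω ≃ₐ[K] Ω) N isClosed_ker_algEquivRestrictAlgebraicClosure p m' m hN hQ
  exact (fieldCdLE_iff_groupCdLE_algEquiv K Ω p (m' + m)).2 hG

/-- The same inequality with the roles of the summands in the printed order
`cd_p(k') ≤ cd_p H + cd_p(k)`, `H = Γ_{k̄(t)}` as a group: `cd_p(Γ_{k̄(t)}) ≤ m' → cd_p(k) ≤ m →
cd_p(k(t)) ≤ m' + m`, `cd_p(Γ_{k̄(t)})` being tested on any group `≃ₜ*` to `Γ_{k̄(t)}` — here the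
closed subgroup `Gal(Ω/K k̄) = ker (Aut_K(Ω) → Aut_k(k̄))` of `Aut_K(Ω)` ("the letters `H`,
`G_{k(t)}` represent the Galois groups of the extensions as shown", Shatz p. 119).
[cite: Shatz1972, Ch. IV §4, proof of Thm. 28, p. 119] -/
theorem fieldCdLE_adjoin_simple_of_tower_of_ker (hT : tower_groupCdLE_of_isClosed_normal.{u})
    (k K Ω : Type u) [Field k] [Field K] [Field Ω] [Algebra k K] [Algebra K Ω] [Algebra k Ω]
    [IsScalarTower k K Ω] [IsAlgClosure K Ω] [IsAlgClosed Ω] (t : K) (ht : Transcendental k t)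
    (htop : IntermediateField.adjoin k ({t} : Set K) = ⊤) (p : ℕ) [Fact p.Prime] (m m' : ℕ)
    (hH : GroupCdLE (algEquivRestrictAlgebraicClosure k K Ω).ker p m') (hk : FieldCdLE k p m) :
    FieldCdLE K p (m' + m) :=
  fieldCdLE_adjoin_simple_of_tower hT k K Ω t ht htop p m m' hk
    (GroupCdLE.of_continuousMulEquiv (kerRestrictContinuousMulEquivAbsoluteGaloisGroup htop) hH)

end Literature.NumberTheory.GaloisRepresentations

end
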